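import Literature.AlgebraicGeometry.HodgeTheory.ComplexTorusIntegralHodgeClassesKunnethProjectorsTraces
import HarnessLib

/-!
# `deg(π_{2g−d} · [Δ_X]) = (−1)ᵈ b_d(X) = (−1)ᵈ C(2g, d)`: the Künneth projectors against the diagonal

Sequel of g29-#9 (`ComplexTorusIntegralHodgeClassesKunnethProjectorsTraces`: `deg((π_a ∘ α) · [Δ_X]) = (−1)ᵈ Tr(α^* | Hᵈ(X))`). For `α = [Δ_X]` itself — `π_a ∘ [Δ] = π_a`
(Prop. 6.3.11 / the unit, g29-#8), `[Δ]^* = Id` (Voisin p. 287, Layer A `corrMapT_cycleForm_diagonal`) — Fulton's graded Lefschetz formula (Example 16.1.15) reads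
`deg_{X×X}(π_a · [Δ_X]) = (−1)ᵈ Tr(Id | Hᵈ(X, ℂ)) = (−1)ᵈ b_d(X)` with `b_d(X) = dim Hᵈ(X, ℂ) = C(2g, d)` for a complex torus of dimension `g` (Lange Prop. 1.1.20 /
Exercise 1.1.6 (8), Layer A `CorrRing.finrank_alt_eq_choose`): the `d`-th term of the Lefschetz number `deg([Δ]·[Δ]) = Σ (−1)ᵈ b_d = χ(X)` is the intersection
number of the Künneth projector `π_{2g−d}` with the diagonal.

* **`cast_integralHodgeClassesDeg_kunnethProjector_cup_diagonalClass`** — `deg(π_a · [Δ_X]) = (−1)ᵈ C(2g, d)` in `ℂ` (`a + d = 2g`), and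
  **`integralHodgeClassesDeg_kunnethProjector_cup_diagonalClass`** — the same in `ℤ`.

## References
* [Fulton1998] W. Fulton, Intersection Theory, 2nd ed., Springer 1998, §16.1 Example 16.1.15 (p0302 L27–L40).
* [Lange2023AbelianVarietiesComplex] H. Lange, Abelian Varieties over the Complex Numbers, Springer 2023, §1.1.4 Prop. 1.1.20, §6.3.4 Prop. 6.3.11 (p0319 L9–L21).
* [VoisinHodgeI2002] C. Voisin, Hodge Theory and Complex Algebraic Geometry I, CUP 2002, §11.3.3 p. 287.
-/

noncomputable section

open CategoryTheory Function

namespace Literature.AlgebraicGeometry.HodgeTheory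

open Literature.AlgebraicGeometry.Motives Literature.AlgebraicGeometry.Motives.HodgeStructure
open Literature.Geometry.Kaehler Literature.Geometry.Kaehler.ComplexTorus

namespace ComplexTorusCat

section Diagonal

variable (X : ComplexTorusCat) {g₁ g : ℕ} (hgg : g₁ + g₁ = g) (eX : Fin (2 * g₁) ≃ X.toIsog.ι) (e : Fin (2 * g) ≃ (prodObj X X).toIsog.ι)
  (hX : 2 * g₁ + 2 * 0 = 2 * g₁) (hg₁ : g₁ + g₁ = 2 * g₁) (hc : 2 * g₁ + 2 * g₁ = 2 * g) (hg' : g + g = 2 * g)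

/-- **`deg_{X×X}(π_a · [Δ_X]) = (−1)ᵈ · C(2g, d)` for `a + d = 2g`** — the Künneth projector `π_a = K_a[Δ_X] ∈ Hᵈ(X) ⊗ Hᵃ(X)` meets the diagonal in the signed Betti
number `(−1)ᵈ b_d(X)`, `b_d(X) = dim_ℂ Hᵈ(X, ℂ) = C(2g, d)`: Fulton's graded Lefschetz formula (g29-#9 `deg((π_a ∘ α) · [Δ]) = (−1)ᵈ Tr(α^*|Hᵈ)`) at `α = [Δ_X]`, with
`π_a ∘ [Δ_X] = π_a` (g29-#8, Prop. 6.3.11) and `[Δ_X]^* = Id` (Layer A `corrMapT_cycleForm_diagonal`), `Tr(Id) = dim` (Layer A `CorrRing.finrank_alt_eq_choose`).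
[cite: Fulton1998, §16.1 Example 16.1.15 (p0302 L36–L40)] [cite: Lange2023AbelianVarietiesComplex, §1.1.4 Prop. 1.1.20 and §6.3.4 Prop. 6.3.11 (p0319 L9–L12)]
[cite: VoisinHodgeI2002, §11.3.3 p. 287] -/
theorem cast_integralHodgeClassesDeg_kunnethProjector_cup_diagonalClass {a d : ℕ} (had : 2 * g₁ = d + a) :
    ((integralHodgeClassesDeg (prodObj X X) e
        (integralHodgeClassesCup (prodObj X X).toIsog.Φ hgg (kunnethProjector X eX e hX hg₁ hc hg' a)
          (integralHodgeClassesPushforward 0 g₁ (diagHom X) eX e hX hg₁ hc hg' (unitIntegralHodgeClass X))) : ℤ) : ℂ) =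
      (-1 : ℂ) ^ d * ((2 * g₁).choose d : ℂ) := by
  obtain ⟨ε₁, hε₁⟩ := exists_orientationSign_eq_one X.toIsog.Φ ((finCongr (by omega : a + d = 2 * g₁)).trans eX)
  set ε : Fin ((a + d) + (d + a)) ≃ X.toIsog.ι ⊕ X.toIsog.ι := (finCongr (by omega : (a + d) + (d + a) = 2 * g)).trans e with hε
  -- `π_a ∘ [Δ_X] = π_a` (composite on `X × (X × X)` in the frame `sumEnum eX e`)
  have hΔ : integralHodgeClassesPushforward g g₁ (liftHom (fstHom X (prodObj X X)) (sndHom X (prodObj X X) ≫ sndHom X X)) (sumEnum eX e) e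
        (rfl : 2 * g₁ + 2 * g = 2 * g₁ + 2 * g) (by omega : (g₁ + g) + (g₁ + g) = 2 * g₁ + 2 * g) hc hg'
        (integralHodgeClassesCup (prodObj X (prodObj X X)).toIsog.Φ hgg
          (integralHodgeClassesPullbackHom (liftHom (fstHom X (prodObj X X)) (sndHom X (prodObj X X) ≫ fstHom X X)) g₁
            (integralHodgeClassesPushforward 0 g₁ (diagHom X) eX e hX hg₁ hc hg' (unitIntegralHodgeClass X)))
          (integralHodgeClassesPullbackHom (sndHom X (prodObj X X)) g₁ (kunnethProjector X eX e hX hg₁ hc hg' a))) =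
      kunnethProjector X eX e hX hg₁ hc hg' a :=
    Subtype.ext (by
      rw [coe_integralHodgeClassesCorrComp_kunnethProjector eX e hX hg₁ hc hg' (sumEnum eX e) e hgg rfl (by omega) hc hg' _ a, coe_kunnethProjector])
  -- `[Δ_X]^* = Id` on `Hᵈ(X)`
  have hid : corrMapT X.toIsog.Φ X.toIsog.Φ ε₁ ε ((SubtorusFrame.diagonal X.toIsog.Φ ε₁ hε₁).cycleForm ε) = LinearMap.id :=
    LinearMap.ext fun β ↦ by rw [LinearMap.id_apply]; exact corrMapT_cycleForm_diagonal X.toIsog.Φ ε₁ hε₁ ε β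
  rw [← hΔ, cast_integralHodgeClassesDeg_corrComp_kunnethProjector_cup_diagonalClass_eq_trace X hgg eX e hX hg₁ hc hg' (sumEnum eX e) rfl (by omega) hc had ε₁ ε,
    domDomCongr_coe_integralHodgeClassesPushforward_diagHom_unitIntegralHodgeClass X eX e hX hg₁ hc hg' had ε₁ hε₁ ε, hid, LinearMap.trace_id,
    CorrRing.finrank_alt_eq_choose X.toIsog.Φ ((finCongr hg₁).trans eX) d, ← two_mul]

/-- **`deg_{X×X}(π_a · [Δ_X]) = (−1)ᵈ · C(2g, d)` in `ℤ`** (`a + d = 2g`). [cite: Fulton1998, §16.1 Example 16.1.15 (p0302 L36–L40)]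
[cite: Lange2023AbelianVarietiesComplex, §1.1.4 Prop. 1.1.20] -/
theorem integralHodgeClassesDeg_kunnethProjector_cup_diagonalClass {a d : ℕ} (had : 2 * g₁ = d + a) :
    integralHodgeClassesDeg (prodObj X X) e
        (integralHodgeClassesCup (prodObj X X).toIsog.Φ hgg (kunnethProjector X eX e hX hg₁ hc hg' a)
          (integralHodgeClassesPushforward 0 g₁ (diagHom X) eX e hX hg₁ hc hg' (unitIntegralHodgeClass X))) =
      (-1 : ℤ) ^ d * ((2 * g₁).choose d : ℤ) := by
  have h := cast_integralHodgeClassesDeg_kunnethProjector_cup_diagonalClass X hgg eX e hX hg₁ hc hg' had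
  exact_mod_cast h

end Diagonal

end ComplexTorusCat

end Literature.AlgebraicGeometry.HodgeTheory
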